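import Mathlib.Analysis.SpecificLimits.Normed
import Summits.QuantumAdvantage.QuantumAdvantage.Theorems.SymplecticPurityNoFreeFramePurity
import Summits.QuantumAdvantage.QuantumAdvantage.Theorems.SymplecticPurityNoFreeFrameUniform
import Summits.QuantumAdvantage.QuantumAdvantage.Theorems.SymplecticPurityNoFreeFrameCoord
import Summits.QuantumAdvantage.QuantumAdvantage.Theorems.SymplecticPurityCubeGraphFlat

/-!
# Route `SymplecticPurity`, item `NoFreeFrame` (stmt-QuantumAdvantage-10731): `¬ H_FF`

**The complexity-level kill.** `H_FF` asserts: every uniform oracle-free Clifford+T family `F`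
admits `c` such that every intermediate state `F.stateAfter x j`, in SOME Clifford frame `U`
(unitary, normalising the Pauli group up to phases), has purity `≥ 1/(|x|^c + c)` across EVERY linear
cut. `noFreeFrame_proof : NoFreeFrame` refutes it with the ancilla-free witness family `cubeFamily`:

* it is oracle-free and polynomial-time uniform (`…Uniform`);
* on the input `0ⁿ`, `n = 2·3^k`, its final state is the normalised graph state `2^{-n/2} Σ_y |y⟩|y³⟩`
  of the cube map of `𝔽₂[X]/(Φ_{3^{k+1}}) ≅ 𝔽_{2ⁿ}` (`…Family`, `…Coord`, `…Cyclo`);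
* that state is `ε`-flat with `ε = 2·2^{-n/2}` (the route's `CubeGraphFlat`, proved in the tree as
  `CubeGraphFlat_proof`, stmt-QuantumAdvantage-9836);
* a unit `ε`-flat state has, in every Clifford frame, purity `≤ 2^{-h} + 2^{h} ε² = 5·2^{-h}` across
  the cut `h = n/2` (`norm_puritySum_mulVec_le`, the ancilla-free case of `SymplecticPurityBound`);
* and `5·2^{-3^k} < 1/((2·3^k)^c + c)` for `k` large.
-/

noncomputable section

set_option linter.dupNamespace false -- D-0017: single-problem summit ⇒ `QuantumAdvantage.QuantumAdvantage` by design

namespace Summit.QuantumAdvantage.QuantumAdvantage.Theorems.SymplecticPurity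

open Matrix Finset Filter Topology
open Literature.Computability.QuantumComplexity Literature.Computability.Cryptography

/-! ### Normalised graph states: norm and Pauli expectations -/

section Graph

variable {m : ℕ}

/-- Sums over a doubled register split along `Fin.append`. -/
private theorem sum_QReg_add {M : Type*} [AddCommMonoid M] (G : QReg (m + m) → M) :
    ∑ w, G w = ∑ y : QReg m, ∑ v : QReg m, G (Fin.append y v) := by
  rw [← Equiv.sum_comp (Fin.appendEquiv m m), Fintype.sum_prod_type]
  rfl

/-- Halves of an appended label. -/
private theorem append_castAdd_natAdd_fun (y v : QReg m) :
    (fun i => Fin.append y v (Fin.castAdd m i)) = y ∧ (fun j => Fin.append y v (Fin.natAdd m j)) = v :=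
  ⟨funext fun i => Fin.append_left y v i, funext fun j => Fin.append_right y v j⟩

variable (F : QReg m → QReg m)

/-- The number of points on the graph of `F` inside the doubled register is `2^m`. -/
private theorem card_graph : (univ.filter fun z : QReg (m + m) =>
    (fun l => z (Fin.natAdd m l)) = F (fun i => z (Fin.castAdd m i))).card = 2 ^ m := by
  classical
  have h := sum_QReg_add (fun z : QReg (m + m) =>
    if (fun l => z (Fin.natAdd m l)) = F (fun i => z (Fin.castAdd m i)) then (1 : ℕ) else 0)
  rw [Finset.sum_boole] at h
  simp only [Nat.cast_id] at h
  rw [h]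
  have inner : ∀ y : QReg m, (∑ v : QReg m, if (fun l => Fin.append y v (Fin.natAdd m l)) =
      F (fun i => Fin.append y v (Fin.castAdd m i)) then (1 : ℕ) else 0) = 1 := fun y => by
    rw [Finset.sum_eq_single (F y)]
    · obtain ⟨h1, h2⟩ := append_castAdd_natAdd_fun y (F y)
      rw [if_pos (by rw [h1, h2])]
    · intro v _ hv
      obtain ⟨h1, h2⟩ := append_castAdd_natAdd_fun y v
      rw [if_neg (by rw [h1, h2]; exact hv)]
    · exact fun h => absurd (Finset.mem_univ _) h
  simp only [inner, Finset.sum_const, smul_eq_mul, mul_one, Finset.card_univ, Fintype.card_fun,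
    Fintype.card_bool, Fintype.card_fin]

/-- `‖(1/√2)^m‖² · 2^m = 1`. -/
private theorem norm_invSqrt2_pow_sq : ‖invSqrt2 ^ m‖ ^ 2 * 2 ^ m = 1 := by
  have h : ‖invSqrt2‖ ^ 2 = 1 / 2 := by
    rw [show invSqrt2 = 1 / (Real.sqrt 2 : ℂ) from rfl, Complex.norm_div, norm_one, Complex.norm_real,
      Real.norm_of_nonneg (Real.sqrt_nonneg _), div_pow, one_pow, Real.sq_sqrt (by norm_num)]
  rw [norm_pow, ← pow_mul, mul_comm m 2, pow_mul, h, ← mul_pow]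
  norm_num

/-- **The normalised graph state is a unit vector.** -/
theorem normSq_graphState : normSq (fun z : QReg (m + m) =>
    if (fun l => z (Fin.natAdd m l)) = F (fun i => z (Fin.castAdd m i)) then invSqrt2 ^ m else 0) = 1 := by
  classical
  rw [normSq]
  simp only [apply_ite norm, norm_zero, ite_pow, zero_pow (two_ne_zero), Finset.sum_ite, Finset.sum_const_zero,
    add_zero, Finset.sum_const, card_graph, nsmul_eq_mul, Nat.cast_pow, Nat.cast_ofNat]
  rw [mul_comm]; exact norm_invSqrt2_pow_sq

/-- Bilinearity: the Pauli expectation of a rescaled vector. -/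
private theorem pauliExp_const_mul {N : ℕ} (S : Fin N → Pauli) (c : ℂ) (g : QReg N → ℂ) :
    pauliExp S (fun z => c * g z) = (starRingEnd ℂ c * c) * (star g ⬝ᵥ (pauliString S).mulVec g) := by
  simp only [pauliExp, dotProduct, Matrix.mulVec, Pi.star_apply, star_mul', Complex.star_def, Finset.mul_sum]
  refine Finset.sum_congr rfl fun z _ => Finset.sum_congr rfl fun z' _ => ?_
  ring

/-- **Pauli expectations of the normalised graph state** are `2^{-m}` times those of the graph
vector. -/
theorem pauliExp_graphState (S : Fin (m + m) → Pauli) :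
    pauliExp S (fun z : QReg (m + m) =>
      if (fun l => z (Fin.natAdd m l)) = F (fun i => z (Fin.castAdd m i)) then invSqrt2 ^ m else 0) =
    (starRingEnd ℂ (invSqrt2 ^ m) * invSqrt2 ^ m) *
      (star (fun z : QReg (m + m) =>
        if (fun l => z (Fin.natAdd m l)) = F (fun i => z (Fin.castAdd m i)) then (1 : ℂ) else 0) ⬝ᵥ
        (pauliString S).mulVec (fun z : QReg (m + m) =>
          if (fun l => z (Fin.natAdd m l)) = F (fun i => z (Fin.castAdd m i)) then (1 : ℂ) else 0)) := by
  classical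
  rw [← pauliExp_const_mul]
  congr 1
  funext z
  split_ifs <;> simp

end Graph

/-! ### Flatness of the witness state at the good input lengths -/

/-- **The final state of the witness family is `2·2^{-n/2}`-flat** at `n = 2·3^k`: for every
Pauli string `S ≠ I`, `|⟨ψ|σ_S|ψ⟩| ≤ (1/2)^n · 2√2ⁿ`, where `ψ` is the normalised graph state of
`cubeMap n` (stated for a variable `m = 2·3^k` to be instantiated at `m = |x|`). -/
theorem pauliExp_cubeState_le (k m : ℕ) (hm : m = 2 * 3 ^ k) (S : Fin (m + m) → Pauli)
    (hS : S ≠ fun _ => Pauli.I) :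
    ‖pauliExp S (fun z : QReg (m + m) =>
      if (fun l => z (Fin.natAdd m l)) = cubeMap m (fun i => z (Fin.castAdd m i)) then invSqrt2 ^ m else 0)‖ ≤
      (1 / 2 : ℝ) ^ m * (2 * Real.sqrt 2 ^ m) := by
  subst hm
  rw [pauliExp_graphState, norm_mul, Complex.norm_mul, Complex.norm_conj, ← sq]
  have hc : ‖invSqrt2 ^ (2 * 3 ^ k)‖ ^ 2 = (1 / 2 : ℝ) ^ (2 * 3 ^ k) := by
    have := norm_invSqrt2_pow_sq (m := 2 * 3 ^ k)
    rw [one_div, inv_pow]; exact eq_inv_of_mul_eq_one_left this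
  rw [hc]
  refine mul_le_mul_of_nonneg_left ?_ (by positivity)
  -- the graph vector of `cubeMap (2·3^k)` is the cube graph vector of `CubeGraphFlat`
  haveI : Fact (Irreducible (cubePoly k)) := fact_irreducible_cubePoly k
  letI : Fintype (AdjoinRoot (cubePoly k)) := Fintype.ofEquiv _ (cubeEquiv k).symm.toEquiv
  have hK : Fintype.card (AdjoinRoot (cubePoly k)) = 2 ^ (2 * 3 ^ k) := card_cubeField k
  have h := CubeGraphFlat_proof (2 * 3 ^ k) (AdjoinRoot (cubePoly k)) hK (cubeEquiv k) S hS
  simp only [cubeMap_eq_cube k]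
  exact h

/-! ### The witness input -/

/-- The all-zero input of length `n`. -/
private theorem replicate_get (n : ℕ) (i : Fin (List.replicate n false).length) :
    (List.replicate n false).get i = false :=
  List.eq_of_mem_replicate (List.get_mem _ _)

/-! ### The asymptotics: `5·2^{-h}` beats `1/((2h)^c + c)` -/

/-- For every `c`, eventually `(5·2^c·h^c + 5c)·(1/2)^h < 1`. -/
private theorem eventually_small (c : ℕ) : ∃ H : ℕ, ∀ h : ℕ, H ≤ h →
    (5 * 2 ^ c * (h : ℝ) ^ c + 5 * c) * (1 / 2 : ℝ) ^ h < 1 := by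
  have h1 : Tendsto (fun h : ℕ => (h : ℝ) ^ c * (1 / 2 : ℝ) ^ h) atTop (𝓝 0) :=
    tendsto_pow_const_mul_const_pow_of_abs_lt_one c (by rw [abs_of_nonneg (by norm_num)]; norm_num)
  have h2 : Tendsto (fun h : ℕ => (1 / 2 : ℝ) ^ h) atTop (𝓝 0) :=
    tendsto_pow_atTop_nhds_zero_of_lt_one (by norm_num) (by norm_num)
  have h3 : Tendsto (fun h : ℕ => (5 * 2 ^ c * (h : ℝ) ^ c + 5 * c) * (1 / 2 : ℝ) ^ h) atTop (𝓝 0) := by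
    have := (h1.const_mul (5 * (2 : ℝ) ^ c)).add (h2.const_mul (5 * (c : ℝ)))
    rw [mul_zero, mul_zero, add_zero] at this
    refine this.congr fun h => ?_
    ring
  obtain ⟨H, hH⟩ := eventually_atTop.1 (h3.eventually_lt_const zero_lt_one)
  exact ⟨H, hH⟩

/-! ### The kill -/

/-- **`¬ H_FF`** (route `SymplecticPurity`, item `NoFreeFrame`, stmt-QuantumAdvantage-10731): no
uniform bound `1/poly` on the frame-minimised linear-cut purity holds for the witness family
`cubeFamily`. -/
theorem noFreeFrame_proof : Summit.QuantumAdvantage.QuantumAdvantage.Theses.SymplecticPurity.NoFreeFrame := by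
  intro hFF
  obtain ⟨c, hc⟩ := hFF cubeFamily cubeFamily_isOracleFree cubeFamily_isUniform
  -- choose the input length `n = 2h`, `h = 3^H` with `H` from the asymptotics
  obtain ⟨H, hH⟩ := eventually_small c
  set h : ℕ := 3 ^ H with hh
  have hHh : H ≤ h := (Nat.lt_pow_self (by norm_num : 1 < 3)).le
  have hsmall := hH h hHh
  set x : List Bool := List.replicate (2 * h) false with hxdef
  have hxlen : x.length = 2 * 3 ^ H := List.length_replicate
  have hx0 : ∀ i, x.get i = false := replicate_get (2 * h)
  have hxpos : 0 < x.length := by rw [hxlen]; positivity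
  obtain ⟨U, hU, hcl, hbound⟩ := hc x (cubeGates x.length).length
  -- the route's purity sum is `puritySum`; take the cut `h`
  have hcut : h ≤ x.length + x.length := by rw [hxlen]; omega
  have hb := hbound h hcut
  change (1 : ℝ) / (x.length ^ c + c) ≤ ‖puritySum h (U.mulVec (cubeFamily.stateAfter x (cubeGates x.length).length))‖
    at hb
  -- the state, its norm and its flatness
  rw [cubeFamily_stateAfter x hx0 hxpos] at hb
  have hnorm := normSq_graphState (cubeMap x.length)
  have hflat := pauliExp_cubeState_le H x.length hxlen
  have hpur := norm_puritySum_mulVec_le hnorm hflat hU hcl hcut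
  -- numerics: the bound is `5 · (1/2)^h`
  have hval : (2 : ℝ)⁻¹ ^ h + 2 ^ h * ((1 / 2 : ℝ) ^ x.length * (2 * Real.sqrt 2 ^ x.length)) ^ 2 =
      5 * (1 / 2 : ℝ) ^ h := by
    rw [hxlen, ← hh, pow_mul (Real.sqrt 2) 2 h, Real.sq_sqrt (by norm_num : (0 : ℝ) ≤ 2), one_div, inv_pow,
      inv_pow, pow_mul' (2 : ℝ) 2 h]
    have h2 : (0 : ℝ) < 2 ^ h := by positivity
    field_simp
    ring
  rw [hval] at hpur
  have hle := hb.trans hpur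
  -- contradiction with the asymptotics
  rw [hxlen, ← hh] at hle
  have hden : (0 : ℝ) < ((2 * h : ℕ) : ℝ) ^ c + c := by positivity
  rw [div_le_iff₀ hden] at hle
  have : (5 * 2 ^ c * (h : ℝ) ^ c + 5 * c) * (1 / 2 : ℝ) ^ h = 5 * (1 / 2 : ℝ) ^ h * (((2 * h : ℕ) : ℝ) ^ c + c) := by
    push_cast; ring
  linarith

end Summit.QuantumAdvantage.QuantumAdvantage.Theorems.SymplecticPurity
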